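import Summits.PneNP.PneNP.Theorems.KarlinRubinMonotoneSufficesRoomCircuit

/-!
# Crux `MonotoneSuffices` (stmt-PneNP-18026), the COVERING-DESIGN room theorem — part 3:
# the family detector is a small monotone circuit

For every `n, t, θ`, every `m ≥ 1` and every family `T : Fin m → {t-sets of vertices of Kₙ}` there is a
circuit over `{∧₂, ∨₂, 0, 1}` on the edges of `Kₙ` with at most `m · (n (t+1) + 60 (n+3)^4 + 1)` gates
computing `D x = [∃ i, θ ≤ #{u ∉ T i : x ≡ 1 on star (T i) u}]` (`exists_family_detector_circuit`).
Same three layers as the room detector (`Room.exists_detector_circuit`), indexed by `Fin m` instead of all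
`t`-sets: the `m · n` ANDs of the stars (`Room.cktSize_starAnd`), one monotone counting threshold per
member (`stub_integerThresholdCircuit`, `60 (n+3)^4` gates), an OR over the members.
No probability here.
-/

set_option linter.dupNamespace false -- `Summit.PneNP.PneNP.…`: summit = sub-problem name (D-0017 single-conjunct layout)

namespace Summit.PneNP.PneNP.Theorems.MonotoneSuffices.Cover

open Finset Literature.Computability.Complexity
open Summit.PneNP.PneNP.Theorems.CliqueExtLowerBound.WidthThreshold.ThresholdCircuit (stub_integerThresholdCircuit)
open Summit.PneNP.PneNP.Theorems.MonotoneSuffices.Room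

variable {n : ℕ}

/-- **The family detector circuit.** For `0 < m`, any `θ` and any family `T : Fin m → _` of `t`-sets of
vertices, the test `D x = [∃ i, θ ≤ #{u ∉ T i : x ≡ 1 on star (T i) u}]` on the edges of `Kₙ` has a circuit
over `{∧₂, ∨₂, 0, 1}` with at most `m · (n (t+1) + 60 (n+3)^4 + 1)` gates. [folklore] -/
theorem exists_family_detector_circuit (n t θ m : ℕ) (hm : 0 < m) (T : Fin m → Finset (Fin n))
    (hT : ∀ i, #(T i) = t) :
    ∃ C : Circuit ((⊤ : SimpleGraph (Fin n)).edgeSet), C.IsOver monotoneBasis01 ∧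
      C.size ≤ m * (n * (t + 1) + 60 * (n + 3) ^ 4 + 1) ∧
      ∀ x, C.eval x = decide (∃ i : Fin m,
        θ ≤ #((univ \ T i).filter fun u => ∀ e ∈ (univ.filter fun e : (⊤ : SimpleGraph (Fin n)).edgeSet =>
          ∃ w ∈ T i, (e : Sym2 (Fin n)) = s(u, w)), x e = true)) := by
  classical
  haveI : Nonempty (Fin m) := ⟨⟨0, hm⟩⟩
  -- layer 1: all the star ANDs
  have hA : CktSize monotoneBasis01 (fun (x : (⊤ : SimpleGraph (Fin n)).edgeSet → Bool)
      (p : Fin m × Fin n) =>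
      decide (p.2 ∉ T p.1 ∧ ∀ e ∈ (univ.filter fun e : (⊤ : SimpleGraph (Fin n)).edgeSet =>
        ∃ w ∈ T p.1, (e : Sym2 (Fin n)) = s(p.2, w)), x e = true))
      (Fintype.card (Fin m × Fin n) * (t + 1)) :=
    CktSize.pi_const fun p => by
      have h := cktSize_starAnd (T p.1) p.2
      rw [hT p.1] at h
      exact h
  -- layer 2: one counting threshold per member
  have hB : CktSize monotoneBasis01 (fun (y : Fin m × Fin n → Bool) (i : Fin m) =>
      decide (θ ≤ ∑ j : Fin n, (1 * if y (i, j) then 1 else 0)))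
      (Fintype.card (Fin m) * (60 * (n + 3) ^ 4)) :=
    CktSize.pi_const fun i => by
      obtain ⟨Ψ, hΨB, hΨs, hΨe⟩ := stub_integerThresholdCircuit n 1 (fun _ => 1) θ (fun _ => by norm_num)
      have e3 : 60 * (n + 1 + 2) ^ 4 = 60 * (n + 3) ^ 4 := by ring
      have h := ((Ψ.cktSize_eval hΨB).rewire (ι' := Fin m × Fin n) fun j => (i, j)).of_le (hΨs.trans e3.le)
      refine h.congr fun y _ => ?_
      rw [hΨe]
  -- layer 3: the OR over the members
  have hC : CktSize monotoneBasis01 (fun (z : Fin m → Bool) (_ : Unit) => decide (∃ k, z k = true))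
      (Fintype.card (Fin m)) := by
    have hne : (Finset.univ : Finset (Fin m)).toList ≠ [] := by
      rw [Ne, Finset.toList_eq_nil, Finset.univ_eq_empty_iff]
      exact not_isEmpty_of_nonempty _
    have h := (cktSize_any (Finset.univ : Finset (Fin m)).toList hne).basis_mono
      monotoneBasis_subset_monotoneBasis01
    rw [Finset.length_toList, Finset.card_univ] at h
    refine h.congr fun z _ => ?_
    apply Bool.eq_iff_iff.2
    rw [List.any_eq_true, decide_eq_true_iff]
    simp [Finset.mem_toList]
  have hABC := (hA.comp hB).comp hC
  have hsize : Fintype.card (Fin m × Fin n) * (t + 1) + Fintype.card (Fin m) * (60 * (n + 3) ^ 4) +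
      Fintype.card (Fin m) = m * (n * (t + 1) + 60 * (n + 3) ^ 4 + 1) := by
    rw [Fintype.card_prod, Fintype.card_fin, Fintype.card_fin]; ring
  obtain ⟨C, hCB, hCs, hCe⟩ := (hABC.of_le hsize.le).toCircuit
  refine ⟨C, hCB, hCs, fun x => ?_⟩
  rw [hCe]
  have hsum : ∀ S : Finset (Fin n),
      (∑ j : Fin n, (1 * if decide (j ∉ S ∧ ∀ e ∈ (univ.filter fun e : (⊤ : SimpleGraph (Fin n)).edgeSet =>
        ∃ w ∈ S, (e : Sym2 (Fin n)) = s(j, w)), x e = true) = true then 1 else 0)) =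
      #((univ \ S).filter fun u => ∀ e ∈ (univ.filter fun e : (⊤ : SimpleGraph (Fin n)).edgeSet =>
        ∃ w ∈ S, (e : Sym2 (Fin n)) = s(u, w)), x e = true) := fun S => sum_indicator_eq_card S _
  apply Bool.eq_iff_iff.2
  simp only [hsum]
  simp only [decide_eq_true_eq]

end Summit.PneNP.PneNP.Theorems.MonotoneSuffices.Cover

namespace Summit.PneNP.PneNP.Theorems.MonotoneSuffices.Cover

open Finset

/-- Registered sub-goal `cover_circuit` of stmt-PneNP-18026 (covering-design room theorem, part 3): the family
detector circuit, exported verbatim. [folklore] -/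
theorem cover_circuit :
    ∀ (n t θ m : ℕ), 0 < m → ∀ (T : Fin m → Finset (Fin n)), (∀ i, #(T i) = t) → ∃ C : Literature.Computability.Complexity.Circuit ((⊤ : SimpleGraph (Fin n)).edgeSet), C.IsOver Literature.Computability.Complexity.monotoneBasis01 ∧ C.size ≤ m * (n * (t + 1) + 60 * (n + 3) ^ 4 + 1) ∧ ∀ x, C.eval x = decide (∃ i : Fin m, θ ≤ #((Finset.univ \ T i).filter fun u => ∀ e ∈ (Finset.univ.filter fun e : (⊤ : SimpleGraph (Fin n)).edgeSet => ∃ w ∈ T i, (e : Sym2 (Fin n)) = s(u, w)), x e = true)) :=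
  fun n t θ m hm T hT => exists_family_detector_circuit n t θ m hm T hT

end Summit.PneNP.PneNP.Theorems.MonotoneSuffices.Cover
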